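import Summits.QuantumFields.YangMills.Theorems.BalabanUVNodesN07FrakGOfRecordGaugeCovariance
import Literature.MathematicalPhysics.QuantumFieldTheory.Balaban1983to89.B9Eq3119DeltaPiTowerFlat
import Literature.MathematicalPhysics.QuantumFieldTheory.Balaban1983to89.B9Eq3124GaugeModes
import HarnessLib

/-!
# NODE N07 — [15] p.294 «𝔊 … satisfying the equalities Q𝔊 = 0, RD*𝔊 = 0» FOR def-Y's HANDLE `frakGOfRecordAtBgFlat`, DISCHARGED ON THE GAUGE ORBIT OF THE
# FLAT BACKGROUND: `𝔊(u • 1)` MAPS THE CURRENTS INTO THE CONSTRAINT SLICE (102) `{QA₁ = 0, RD*A₁ = 0}`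

Cell `pub-ymgap`, width seat `pub-ymgap-dag-n07-w3` (g24), CLAIM-8.  `--kind proof --supports stmt-QuantumFields-27238 --as helper`; count-neutral.
[B9] = [Balaban1985BackgroundPropagators]; [15] = [Balaban1985Variational].

WHY.  [15] p.294: *«In [5] we have proved that the operator G₁𝔓* is equal to the operator 𝔊 defined by (3.148) and satisfying the equalities Q𝔊 = 0, RD*𝔊 = 0»* —
the range of 𝔊 lies in the slice (102)∕(109), which is what makes the fixed point of (116) a configuration of the constrained variational problem.  Lit keeps these
as the DISPLAYED (3.124)-letters `h124`, `h124′`, `hRDR` of ✓`B11Eq103H1Complex.frakGLatticeCLM_mem_constraint102`, reduced by ✓`B9Eq3124GaugeModes` to two gauge-mode facts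
about the DATA: (g1) `Q′λ = 0 → Δ₁(Dλ) = 0` and (g2) `Q′λ = 0 → Q(Dλ) = 0`.  For def-Y's pinned letters (`Δ₁ = hessOpOfRecord`, the bare [B9] (3.10) Hessian; `Q = QOfRecord`,
`Q′ = QflatOfRecord`) (g1)∕(g2) HOLD at the flat background — (g1) = print's (3.117) at `J = 0` (lit ✓`B9Eq3119DeltaPiTowerFlat.hessOp_one_covDerivL2K`), (g2) = the
(1.55)-consistency ✓p816354 `QOfRecord_one_covDerivL2K` — and transfer to every pure gauge `u • 1` by the covariances of ✓p816707∕✓p817063; away from the flat orbit (g1) is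
only «almost» true for the bare Hessian ([B9] (3.117), error ∝ J(U₀)), which is why print passes to Δ_π there (not this file).

WHAT IS PROVED (sorry-free; no definition; axioms standard).
* §1 (g1)∕(g2) at `U₀ = 1`: `hessOpOfRecord_one_covDerivL2K` (`Δ₁(1)(D₁λ) = 0`, every `λ`), `QOfRecord_one_covDerivL2K_eq_zero` (`Q′♭λ = 0 → Q(1)(D₁λ) = 0`); `hessOpOfRecord_one_isSymmetric`.
* §2 the same on the orbit: `hessOpOfRecord_pureGauge_covDerivL2K`, `QOfRecord_pureGauge_covDerivL2K_eq_zero` (`k ≤ m + K`), `hessOpOfRecord_pureGauge_isSymmetric`.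
* §3 ★★★ `frakGOfRecordAtBgFlat_one_mem_constraint102`, ★★★ `frakGOfRecordAtBgFlat_pureGauge_mem_constraint102` — `𝔊(u • 1) f ∈ (102)` for every current `f` and all displayed
  `hpos`, `hQ`; unpacked: ★★★ `Q_frakGOfRecordAtBgFlat_pureGauge` (`Q(u • 1)(𝔊(u • 1) f) = 0`) and ★★★ `RDstar_frakGOfRecordAtBgFlat_pureGauge` (`R D*(𝔊(u • 1) f) = 0`).

HONEST SCOPE.  Flat orbit only: at a general guarded `U₀` the bare-Hessian handle does NOT satisfy (g1) (print's Δ_π does, by construction — ✓`B9Eq3119InvariantExtension`); `hpos`,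
`hQ` stay DISPLAYED (inhabited on the flat orbit by ✓p817063 ∕ ✓p815831); nothing of [B9]∕[15] asserted; no estimate; P0 OPEN; N07 NOT discharged; K0ᴬ∕K1ᴬ∕K3ᴬ OPEN; counts unmoved
(28∕28 · 8∕28 · K 1∕4); one finite 𝕋⁴ programme at fixed ε — R4 closes the conditional finite-𝕋⁴ rung `BalabanLadder.UV` only, never the summit; nothing continuum ∕ ℝ⁴ ∕ OS; the
Yang–Mills mass gap (Clay) is NOT proved by any of this.  No `sorry`, no `def`, no `instance`, no `notation`; two `set_option maxRecDepth 16384 in` (the definitional unfolding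
`frakGOfRecordAtBgFlat ↦ frakGOfRecord ↦ frakGLatticeCLM` against lit's lemma is deep, not expensive: the file elaborates in seconds).

References: [15] (102) p.293, (109)–(111) p.294; [B9] (3.117) p.419, (3.124) p.420, (3.152)–(3.153) p.426, (3.10) p.392.
-/

set_option autoImplicit false

noncomputable section

open scoped Matrix.Norms.L2Operator InnerProductSpace ComplexConjugate

namespace Summit.QuantumFields.YangMills.Theorems.N07FrakGOfRecordSliceFlat

open Literature.MathematicalPhysics.QuantumFieldTheory.Balaban1983to89
open Literature.MathematicalPhysics.QuantumFieldTheory.Balaban1983to89.T4Continuum (T4Family)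
open T4Continuum BlockAveraging
open B4Sect5Torus (TSite)
open B9SectCLatticeCarrier (Bond bpos btgt)
open B9Eq311L2Pairing (WL2)
open B11Eq115Space (NegSup JetSup)
open B11Eq111FrakG (nabla115 constraint102 mem_constraint102_iff)
open B11Eq103H1Complex (SiteL2K BondL2K covDerivL2K covDivL2K funEquiv QFun DstarFun)
open B9Eq328GaugeAction (gaugeW inner_gaugeW gaugeW_apply_inv)
open B16Sect1Backgrounds (toMS)
open B15DeterminingSets (embIter)
open Node00
open Summit.QuantumFields.YangMills.Theorems.N07LaplaceAOfRecordFlatForm (hessOpOfRecord_one unitsOfRecord_one)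
open Summit.QuantumFields.YangMills.Theorems.N07LaplaceAOfRecordFlatPos (QOfRecord_one_covDerivL2K)
open Summit.QuantumFields.YangMills.Theorems.N07LaplaceAOfRecordGaugeOrbitPos (inner_AdW_suToUnits hessOpOfRecord_gaugeAct covDerivL2K_RRec_gaugeAct
  QflatOfRecord_gaugeW_eq_zero_iff QOfRecord_gaugeAct_bpos smallBelow_one)
open GaugeField (gaugeAct)

variable (F : T4Family) (N : ℕ) [NeZero N] {K : ℕ} (k : ℕ)

/-! ## §1  The two gauge-mode facts (g1), (g2) for def-Y's letters at the flat background -/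

/-- **(g1) AT `U₀ = 1`: `Δ₁(1)(D₁λ) = 0` for EVERY gauge parameter `λ`** — the flat bare Hessian `∂*∂` kills all pure gauge modes (print's (3.117) at `J = 0`;
lit ✓`hessOp_one_covDerivL2K` read at the record's letters). [cite: Balaban1985BackgroundPropagators, (3.117) p.419, (3.10) p.392] -/
theorem hessOpOfRecord_one_covDerivL2K [Fact (0 < c0Rec F K k)] (l : SiteL2K ℂ (F.P K).d (fun _ => (F.P K).sitesPerDir 0) (c0Rec F K k) (WRec N)) :
    hessOpOfRecord F N k 1 (covDerivL2K ℂ (c0Rec F K k) (cRec F K k) (RRec F N (1 : GaugeField (F.P K) 0 (SU N))) l) = 0 := by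
  unfold hessOpOfRecord RRec
  rw [unitsOfRecord_one]
  exact B9Eq3119DeltaPiTowerFlat.hessOp_one_covDerivL2K (phiRec N) ((F.P K).eta k) (tauRec N) l

/-- **(g2) AT `U₀ = 1`: `Q′♭λ = 0 → Q(1)(D₁λ) = 0`** — by the (1.55)-consistency ✓`QOfRecord_one_covDerivL2K` the averaged pure gauge mode is the coarse gradient of `Q′♭λ`.
[cite: Balaban1985BackgroundPropagators, (3.115) p.418; Balaban1984PropagatorsI, (1.55) p.27] -/
theorem QOfRecord_one_covDerivL2K_eq_zero [Fact (0 < c0Rec F K k)] (l : SiteL2K ℂ (F.P K).d (fun _ => (F.P K).sitesPerDir 0) (c0Rec F K k) (WRec N))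
    (hl : QflatOfRecord F N k l = 0) :
    QOfRecord F N k (1 : GaugeField (F.P K) 0 (SU N)) (covDerivL2K ℂ (c0Rec F K k) (cRec F K k) (RRec F N (1 : GaugeField (F.P K) 0 (SU N))) l) = 0 := by
  have h := (QflatOfRecord_eq_zero_iff F N k l).1 hl
  have hz : (fun c : PBond (F.P K) k => (phiRec N).symm ((cRec F K k * (((F.P K).L : ℂ) ^ k)⁻¹) •
      (siteFieldIn F N k l (embIter k c.tgt) - siteFieldIn F N k l (embIter k c.src)))) = fun _ => 0 := by
    funext c
    rw [h, h, sub_self, smul_zero, map_zero]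
  rw [QOfRecord_one_covDerivL2K, hz]
  rfl

/-- The flat bare Hessian `Δ₁(1) = ∂*∂` is symmetric. [cite: Balaban1985BackgroundPropagators, (3.10) p.392] -/
theorem hessOpOfRecord_one_isSymmetric [Fact (0 < c0Rec F K k)] : (hessOpOfRecord F N k (1 : GaugeField (F.P K) 0 (SU N))).IsSymmetric := by
  have h := principalOpOfRecord_isSymmetric (F := F) (N := N) (k := k) (1 : GaugeField (F.P K) 0 (SU N))
  rw [unitsOfRecord_one] at h
  rw [hessOpOfRecord_one]
  exact h

/-! ## §2  (g1), (g2) and the symmetry of `Δ₁` at every pure gauge `u • 1` (covariance) -/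

section Orbit

variable (u : GaugeTransf (F.P K) 0 (SU N))

/-- **(g1) ON THE FLAT ORBIT: `Δ₁(u • 1)(D_{u • 1}λ) = 0`** for every `λ` — §1 transported by ✓p817063's (3.30)∕(3.31) covariances.
[cite: Balaban1985BackgroundPropagators, (3.117) p.419, (3.30)–(3.31) p.395] -/
theorem hessOpOfRecord_pureGauge_covDerivL2K [Fact (0 < c0Rec F K k)] (l : SiteL2K ℂ (F.P K).d (fun _ => (F.P K).sitesPerDir 0) (c0Rec F K k) (WRec N)) :
    hessOpOfRecord F N k (gaugeAct u 1) (covDerivL2K ℂ (c0Rec F K k) (cRec F K k) (RRec F N (gaugeAct u 1)) l) = 0 := by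
  obtain ⟨m, rfl⟩ : ∃ m, gaugeW (phiRec N) (fun z : TSite (F.P K).d (fun _ => (F.P K).sitesPerDir 0) => suToUnits N (u ((siteToLit (F.P K) 0).symm z))) m = l :=
    ⟨_, gaugeW_apply_inv (phiRec N) _ l⟩
  rw [covDerivL2K_RRec_gaugeAct F N k u 1 m, hessOpOfRecord_gaugeAct F N k u 1, hessOpOfRecord_one_covDerivL2K, map_zero]

/-- **(g2) ON THE FLAT ORBIT: `Q′♭λ = 0 → Q(u • 1)(D_{u • 1}λ) = 0`** (`k ≤ m + K`) — §1 transported by (3.31)∕(3.32) (✓p817063 ∕ ✓p816707) and the gauge invariance of `N(Q′♭)`.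
[cite: Balaban1985BackgroundPropagators, (3.115) p.418, (3.31)–(3.32) pp.395–396] -/
theorem QOfRecord_pureGauge_covDerivL2K_eq_zero [Fact (0 < c0Rec F K k)] (hk : k ≤ (F.P K).m + (F.P K).K)
    (l : SiteL2K ℂ (F.P K).d (fun _ => (F.P K).sitesPerDir 0) (c0Rec F K k) (WRec N)) (hl : QflatOfRecord F N k l = 0) :
    QOfRecord F N k (gaugeAct u 1) (covDerivL2K ℂ (c0Rec F K k) (cRec F K k) (RRec F N (gaugeAct u 1)) l) = 0 := by
  obtain ⟨m, rfl⟩ : ∃ m, gaugeW (phiRec N) (fun z : TSite (F.P K).d (fun _ => (F.P K).sitesPerDir 0) => suToUnits N (u ((siteToLit (F.P K) 0).symm z))) m = l :=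
    ⟨_, gaugeW_apply_inv (phiRec N) _ l⟩
  have hm : QflatOfRecord F N k m = 0 := (QflatOfRecord_gaugeW_eq_zero_iff F N k u m).1 hl
  rw [covDerivL2K_RRec_gaugeAct F N k u 1 m, QOfRecord_gaugeAct_bpos F N k u 1 hk (smallBelow_one N k), QOfRecord_one_covDerivL2K_eq_zero F N k m hm,
    map_zero]

/-- The bare Hessian at a pure gauge is symmetric (`Δ₁(u • 1) = R(u)Δ₁(1)R(u)⁻¹` with `R(u)` unitary). [cite: Balaban1985BackgroundPropagators, (3.30) p.395, (3.10) p.392] -/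
theorem hessOpOfRecord_pureGauge_isSymmetric [Fact (0 < c0Rec F K k)] : (hessOpOfRecord F N k (gaugeAct u 1)).IsSymmetric := by
  intro x y
  obtain ⟨x₀, rfl⟩ : ∃ x₀, gaugeW (phiRec N) (fun b : Bond (F.P K).d (fun _ => (F.P K).sitesPerDir 0) => suToUnits N (u ((siteToLit (F.P K) 0).symm (bpos b)))) x₀ = x :=
    ⟨_, gaugeW_apply_inv (phiRec N) _ x⟩
  obtain ⟨y₀, rfl⟩ : ∃ y₀, gaugeW (phiRec N) (fun b : Bond (F.P K).d (fun _ => (F.P K).sitesPerDir 0) => suToUnits N (u ((siteToLit (F.P K) 0).symm (bpos b)))) y₀ = y :=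
    ⟨_, gaugeW_apply_inv (phiRec N) _ y⟩
  rw [hessOpOfRecord_gaugeAct F N k u 1 x₀, hessOpOfRecord_gaugeAct F N k u 1 y₀, inner_gaugeW (phiRec N) _ (fun b v w => inner_AdW_suToUnits N _ v w),
    inner_gaugeW (phiRec N) _ (fun b v w => inner_AdW_suToUnits N _ v w)]
  exact hessOpOfRecord_one_isSymmetric F N k x₀ y₀

end Orbit

/-! ## §3  `𝔊` of record maps the currents into the slice (102) on the flat orbit: `Q𝔊 = 0`, `RD*𝔊 = 0` -/

section Slice

variable (u : GaugeTransf (F.P K) 0 (SU N))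

set_option maxRecDepth 16384 in
/-- ★★★ **AT `U₀ = 1`: `𝔊(1) f ∈ (102)` FOR EVERY CURRENT `f`** (all displayed `hpos`, `hQ`) — lit's ✓`frakGLatticeCLM_mem_constraint102_of_gaugeModes` with (g1), (g2) of §1 and the
record's `conj c = c` ∕ mutually adjoint transporters ∕ symmetric `Δ₁(1)` DISCHARGED. [cite: Balaban1985Variational, (102) p.293, (110)–(111) p.294; Balaban1985BackgroundPropagators, (3.124) p.420] -/
theorem frakGOfRecordAtBgFlat_one_mem_constraint102 [Fact (0 < (F.L : ℝ))] [Fact (0 < (F.P K).eta k)] [Fact (0 < c0Rec F K k)] [Fact (∀ c, 0 < wBRec F K k c)]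
    (Ω : ℕ → Set (Site (F.P K) 0)) {a : ℝ}
    (hpos : ∀ x, x ≠ 0 → 0 < RCLike.re ⟪x, laplaceAOfRecord F N k 1 (QOfRecord F N k 1) (QflatOfRecord F N k) a x⟫_ℂ)
    (hQ : Function.Surjective (QOfRecord F N k (1 : GaugeField (F.P K) 0 (SU N)))) (f : NegSizeLit F N K k Ω 3) :
    frakGOfRecordAtBgFlat F N K k Ω 1 a hpos hQ f ∈
      constraint102 (L := (F.L : ℝ)) (η := (F.P K).eta k) (lev₀ := bondLevLit F Ω k) (pairLevLit F Ω k)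
        (nabla115 ((F.P K).eta k) (unitsOfRecord F N (1 : GaugeField (F.P K) 0 (SU N))))
        (QFun (phiRec N) (QOfRecord F N k (1 : GaugeField (F.P K) 0 (SU N))))
        (B11Eq103H1Complex.RLatticeK (cRec F K k) (RRec F N (1 : GaugeField (F.P K) 0 (SU N))) (SRec F N (1 : GaugeField (F.P K) 0 (SU N))) (QflatOfRecord F N k))
        (DstarFun (phiRec N) (covDivL2K ℂ (c0Rec F K k) (cRec F K k) (SRec F N (1 : GaugeField (F.P K) 0 (SU N))))) := by
  have key := B9Eq3124GaugeModes.frakGLatticeCLM_mem_constraint102_of_gaugeModes (phiRec N) hpos hQ (pairLevLit F Ω k)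
    (nabla115 ((F.P K).eta k) (unitsOfRecord F N (1 : GaugeField (F.P K) 0 (SU N)))) (conj_cRec F K k) (inner_RRec_left 1)
    (hessOpOfRecord_one_isSymmetric F N k) (fun l _ => hessOpOfRecord_one_covDerivL2K F N k l) (fun l hl => QOfRecord_one_covDerivL2K_eq_zero F N k l hl) f
  exact key

set_option maxRecDepth 16384 in
/-- ★★★ **ON THE FLAT ORBIT: `𝔊(u • 1) f ∈ (102)` FOR EVERY CURRENT `f`** (`k ≤ m + K`; all displayed `hpos`, `hQ`) — (g1), (g2) of §2 fed to lit's reduction.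
[cite: Balaban1985Variational, (102) p.293, (110)–(111) p.294; Balaban1985BackgroundPropagators, (3.124) p.420, p.398] -/
theorem frakGOfRecordAtBgFlat_pureGauge_mem_constraint102 [Fact (0 < (F.L : ℝ))] [Fact (0 < (F.P K).eta k)] [Fact (0 < c0Rec F K k)]
    [Fact (∀ c, 0 < wBRec F K k c)] (Ω : ℕ → Set (Site (F.P K) 0)) (hk : k ≤ (F.P K).m + (F.P K).K) {a : ℝ}
    (hpos : ∀ x, x ≠ 0 → 0 < RCLike.re ⟪x, laplaceAOfRecord F N k (gaugeAct u 1) (QOfRecord F N k (gaugeAct u 1)) (QflatOfRecord F N k) a x⟫_ℂ)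
    (hQ : Function.Surjective (QOfRecord F N k (gaugeAct u 1))) (f : NegSizeLit F N K k Ω 3) :
    frakGOfRecordAtBgFlat F N K k Ω (gaugeAct u 1) a hpos hQ f ∈
      constraint102 (L := (F.L : ℝ)) (η := (F.P K).eta k) (lev₀ := bondLevLit F Ω k) (pairLevLit F Ω k)
        (nabla115 ((F.P K).eta k) (unitsOfRecord F N (gaugeAct u 1)))
        (QFun (phiRec N) (QOfRecord F N k (gaugeAct u 1)))
        (B11Eq103H1Complex.RLatticeK (cRec F K k) (RRec F N (gaugeAct u 1)) (SRec F N (gaugeAct u 1)) (QflatOfRecord F N k))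
        (DstarFun (phiRec N) (covDivL2K ℂ (c0Rec F K k) (cRec F K k) (SRec F N (gaugeAct u 1)))) := by
  have key := B9Eq3124GaugeModes.frakGLatticeCLM_mem_constraint102_of_gaugeModes (phiRec N) hpos hQ (pairLevLit F Ω k)
    (nabla115 ((F.P K).eta k) (unitsOfRecord F N (gaugeAct u 1))) (conj_cRec F K k) (inner_RRec_left (gaugeAct u 1))
    (hessOpOfRecord_pureGauge_isSymmetric F N k u) (fun l _ => hessOpOfRecord_pureGauge_covDerivL2K F N k u l)
    (fun l hl => QOfRecord_pureGauge_covDerivL2K_eq_zero F N k u hk l hl) f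
  exact key

/-- ★★★ **`Q𝔊 = 0` ON THE FLAT ORBIT**: the averaged configuration `𝔊(u • 1) f` vanishes — the first of [15] p.294's two equalities, for def-Y's handle, unpacked on the underlying
bond function. [cite: Balaban1985Variational, (109) p.294, p.294 («Q𝔊 = 0»)] -/
theorem Q_frakGOfRecordAtBgFlat_pureGauge [Fact (0 < (F.L : ℝ))] [Fact (0 < (F.P K).eta k)] [Fact (0 < c0Rec F K k)] [Fact (∀ c, 0 < wBRec F K k c)]
    (Ω : ℕ → Set (Site (F.P K) 0)) (hk : k ≤ (F.P K).m + (F.P K).K) {a : ℝ}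
    (hpos : ∀ x, x ≠ 0 → 0 < RCLike.re ⟪x, laplaceAOfRecord F N k (gaugeAct u 1) (QOfRecord F N k (gaugeAct u 1)) (QflatOfRecord F N k) a x⟫_ℂ)
    (hQ : Function.Surjective (QOfRecord F N k (gaugeAct u 1))) (f : NegSizeLit F N K k Ω 3) :
    QOfRecord F N k (gaugeAct u 1) ((funEquiv (phiRec N) (fun _ => c0Rec F K k)).symm
      (JetSup.equiv _ _ _ (frakGOfRecordAtBgFlat F N K k Ω (gaugeAct u 1) a hpos hQ f))) = 0 :=
  ((mem_constraint102_iff _ _ _ _ _ _).1 (frakGOfRecordAtBgFlat_pureGauge_mem_constraint102 F N k u Ω hk hpos hQ f)).1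

/-- ★★★ **`RD*𝔊 = 0` ON THE FLAT ORBIT**: `R(u • 1) D*_{u • 1} (𝔊(u • 1) f) = 0` (Landau gauge (21)∕(109)) — the second of [15] p.294's two equalities, for def-Y's handle.
[cite: Balaban1985Variational, (21) p.281, (109) p.294, p.294 («RD*𝔊 = 0»)] -/
theorem RDstar_frakGOfRecordAtBgFlat_pureGauge [Fact (0 < (F.L : ℝ))] [Fact (0 < (F.P K).eta k)] [Fact (0 < c0Rec F K k)] [Fact (∀ c, 0 < wBRec F K k c)]
    (Ω : ℕ → Set (Site (F.P K) 0)) (hk : k ≤ (F.P K).m + (F.P K).K) {a : ℝ}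
    (hpos : ∀ x, x ≠ 0 → 0 < RCLike.re ⟪x, laplaceAOfRecord F N k (gaugeAct u 1) (QOfRecord F N k (gaugeAct u 1)) (QflatOfRecord F N k) a x⟫_ℂ)
    (hQ : Function.Surjective (QOfRecord F N k (gaugeAct u 1))) (f : NegSizeLit F N K k Ω 3) :
    RrOfRecord F N k (gaugeAct u 1) (QflatOfRecord F N k) (covDivL2K ℂ (c0Rec F K k) (cRec F K k) (SRec F N (gaugeAct u 1))
      ((funEquiv (phiRec N) (fun _ => c0Rec F K k)).symm (JetSup.equiv _ _ _ (frakGOfRecordAtBgFlat F N K k Ω (gaugeAct u 1) a hpos hQ f)))) = 0 :=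
  ((mem_constraint102_iff _ _ _ _ _ _).1 (frakGOfRecordAtBgFlat_pureGauge_mem_constraint102 F N k u Ω hk hpos hQ f)).2

end Slice

end Summit.QuantumFields.YangMills.Theorems.N07FrakGOfRecordSliceFlat

end
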